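import Summits.Ventures.HodgeRepro2.T5IsotropicTransitivity
import Summits.Ventures.HodgeRepro2.T5NormOneCharacters

/-!
# T5HyperbolicDet — det : U(ℍ) → E¹ and the elements a character must kill (Tier-5 support, p3)

First half of the kernel witness behind route/T5-route-3.md v0.31 §F.1 («A character of U(W)
(W split, n ≥ 2; U/SU ≅ E¹ by det and SU = [U,U]) is ν′∘det for a character ν′ of E¹, and
det(M_Y) = E¹ (Hilbert 90) forces ν′ = ν_χ»); the second half (Bruhat decomposition and the
factorisation theorem) is `T5HyperbolicCharacters`.

Model: `hypUnitary E` = U(ℍ) ⊂ GL₂(E) of files 23 / 25 / 27 (E a field with an involution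
`star`, ℍ = !![0,1;1,0]), with its upper unipotents `unipUnit y` (ȳ = −y), lower unipotents
`lowerUnit y`, Weyl element `weylUnit` and torus `diagUnit t` = diag(t, t̄⁻¹).  Standing
hypotheses: the involution is non-trivial (`∃ a, star a ≠ a`) and some norm is ≠ 1
(`∃ t ≠ 0, t·star t ≠ 1` — file 23's hypothesis; it fails only for U₂(𝔽₂)).

* `star_det_mul_det`, `detHom`, `detNormOne` — det g · \overline{det g} = 1, so det : U(ℍ) →* E¹;
* `diagHom` (the torus Eˣ →* U(ℍ)), `detHom_diagHom` (det diag(t, t̄⁻¹) = t / t̄) and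
  `detNormOne_surjective` («det(M_Y) = E¹», Hilbert 90 on the torus);
* `map_unipU`, `map_lowerU`, `map_wU`, `map_diagU_of_star_eq` — a character of U(ℍ) kills the
  upper unipotents (file 23), the lower unipotents (w-conjugates), the elements
  w(y) = n(y)·n⁻(−y⁻¹)·n(y), and the split torus diag(u, u⁻¹), u ∈ F^× (`diagU_mul_wU`:
  diag(u, u⁻¹)·w(δ) = w(uδ) for δ trace-zero).

README §8(d): this file uses an L-value-free non-vanishing device: NO.
-/

namespace Summit.Ventures.HodgeRepro2.T5HyperbolicDet

open T5UnipotentCommutator T5IsotropicTransitivity ShimuraData.B3Characters T5NormOneCharacters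

variable {E : Type*} [Field E] [StarRing E]

/-- Complex-conjugation-style involution of `E` as a ring automorphism (Mathlib `starRingAut`). -/
theorem starRingAut_involutive (x : E) : starRingAut (starRingAut x) = x := by
  simp [starRingAut_apply]

section det

/-- The determinant of a unitary element has norm one: `star (det g) * det g = 1`
(take determinants in `gᴴ ℍ g = ℍ`, `det ℍ = −1`). -/
theorem star_det_mul_det (g : GL (Fin 2) E) (hg : g ∈ hypUnitary E) :
    star (mat g).det * (mat g).det = 1 := by
  have h := congrArg Matrix.det ((mem_hypUnitary_iff g).mp hg)
  rw [Matrix.det_mul, Matrix.det_mul, Matrix.det_conjTranspose] at h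
  have hhyp : (hyp : Matrix (Fin 2) (Fin 2) E).det = -1 := by
    simp [hyp, T5LocalHermitian.hyperbolicPlane, Matrix.det_fin_two_of]
  rw [hhyp] at h
  linear_combination -h

/-- `det : U(ℍ) →* Eˣ`. -/
def detHom : hypUnitary E →* Eˣ :=
  (Matrix.GeneralLinearGroup.det).comp (hypUnitary E).subtype

/-- `detHom g` is the determinant of the matrix of `g`. -/
theorem coe_detHom (g : hypUnitary E) : (detHom g : E) = (mat (g : GL (Fin 2) E)).det := by
  simp [detHom, Matrix.GeneralLinearGroup.val_det_apply, mat]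

/-- The determinant of a unitary element lies in the norm-one subgroup E¹. -/
theorem detHom_mem_normOne (g : hypUnitary E) :
    detHom g ∈ normOne (unitsConj (starRingAut : E ≃+* E)) := by
  rw [mem_normOne_iff]
  apply Units.ext
  rw [Units.val_mul, Units.val_one, coe_unitsConj, starRingAut_apply, coe_detHom, mul_comm]
  exact star_det_mul_det _ g.2

/-- `det : U(ℍ) →* E¹`. -/
def detNormOne : hypUnitary E →* normOne (unitsConj (starRingAut : E ≃+* E)) :=
  detHom.codRestrict _ detHom_mem_normOne

/-- `detNormOne g` is `detHom g` as a unit. -/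
theorem coe_detNormOne (g : hypUnitary E) :
    ((detNormOne g : normOne (unitsConj (starRingAut : E ≃+* E))) : Eˣ) = detHom g := rfl

end det

section generators

/-- An upper unipotent `n(y)` (ȳ = −y) as an element of U(ℍ). -/
def unipU (y : E) (hy : star y = -y) : hypUnitary E :=
  ⟨unipUnit y, (unipUnit_mem_hypUnitary_iff y).mpr hy⟩

/-- A lower unipotent `n⁻(y)` (ȳ = −y) as an element of U(ℍ). -/
def lowerU (y : E) (hy : star y = -y) : hypUnitary E :=
  ⟨lowerUnit y, lowerUnit_mem_hypUnitary y hy⟩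

/-- The Weyl element `w = !![0,1;1,0]` as an element of U(ℍ). -/
def weylU : hypUnitary E := ⟨weylUnit, weylUnit_mem_hypUnitary⟩

/-- The torus element `diag(t, t̄⁻¹)` as an element of U(ℍ). -/
def diagU (t : E) (ht : t ≠ 0) : hypUnitary E := ⟨diagUnit t ht, diagUnit_mem_hypUnitary t ht⟩

omit [StarRing E] in
/-- `n⁻(y) = w · n(y) · w⁻¹`. -/
theorem lowerUnit_eq_conj (y : E) : lowerUnit y = weylUnit * unipUnit y * weylUnit⁻¹ := by
  apply Units.ext
  simp only [Units.val_mul]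
  show (!![1, 0; y, 1] : Matrix (Fin 2) (Fin 2) E) = !![0, 1; 1, 0] * !![1, y; 0, 1] * !![0, 1; 1, 0]
  ext i j
  fin_cases i <;> fin_cases j <;> simp [Matrix.mul_apply, Fin.sum_univ_two]

/-- The same identity in U(ℍ). -/
theorem lowerU_eq_conj (y : E) (hy : star y = -y) :
    lowerU y hy = weylU * unipU y hy * weylU⁻¹ := by
  apply Subtype.ext
  rw [Subgroup.coe_mul, Subgroup.coe_mul, Subgroup.coe_inv]
  exact lowerUnit_eq_conj y

variable {M : Type*} [CommGroup M] (φ : hypUnitary E →* M)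

/-- A character of U(ℍ) is trivial on the upper unipotents (file 23's
`character_unip_eq_one`, given one norm ≠ 1). -/
theorem map_unipU (hn : ∃ t : E, t ≠ 0 ∧ t * star t ≠ 1) (y : E) (hy : star y = -y) :
    φ (unipU y hy) = 1 := by
  obtain ⟨t, ht, htn⟩ := hn
  exact character_unip_eq_one φ t ht htn y hy

/-- A character of U(ℍ) is trivial on the lower unipotents (conjugates of the upper ones). -/
theorem map_lowerU (hn : ∃ t : E, t ≠ 0 ∧ t * star t ≠ 1) (y : E) (hy : star y = -y) :
    φ (lowerU y hy) = 1 := by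
  rw [lowerU_eq_conj, map_mul, map_mul, map_inv, map_unipU φ hn, mul_one, mul_inv_cancel]

/-- `−y⁻¹` is trace-zero when `y` is. -/
theorem star_neg_inv {y : E} (hy : star y = -y) : star (-y⁻¹) = -(-y⁻¹) := by
  rw [star_neg, star_inv₀, hy, inv_neg, neg_neg]

/-- `w(y) := n(y) · n⁻(−y⁻¹) · n(y) = !![0, y; −y⁻¹, 0]` as an element of U(ℍ). -/
def wU (y : E) (hy : star y = -y) : hypUnitary E :=
  unipU y hy * lowerU (-y⁻¹) (star_neg_inv hy) * unipU y hy

/-- A character of U(ℍ) is trivial on every `w(y)`. -/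
theorem map_wU (hn : ∃ t : E, t ≠ 0 ∧ t * star t ≠ 1) (y : E) (hy : star y = -y) :
    φ (wU y hy) = 1 := by
  unfold wU
  rw [map_mul, map_mul, map_unipU φ hn, map_lowerU φ hn, mul_one, mul_one]

/-- `u·δ` is trace-zero for `u` fixed and `δ` trace-zero. -/
theorem star_mul_of_fixed {u δ : E} (hu : star u = u) (hδ : star δ = -δ) :
    star (u * δ) = -(u * δ) := by
  rw [star_mul, hu, hδ]
  ring

/-- THE TORUS RELATION: `diag(u, u⁻¹) · w(δ) = w(u·δ)` for `u` fixed by the involution (the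
matrices `!![u,0;0,u⁻¹] · !![0,δ;−δ⁻¹,0] = !![0,uδ;−(uδ)⁻¹,0]`). -/
theorem diagU_mul_wU (u : E) (hu : u ≠ 0) (hus : star u = u) (δ : E) (hδ0 : δ ≠ 0)
    (hδ : star δ = -δ) :
    diagU u hu * wU δ hδ = wU (u * δ) (star_mul_of_fixed hus hδ) := by
  apply Subtype.ext
  simp only [diagU, wU, unipU, lowerU, Subgroup.coe_mul]
  apply Units.ext
  simp only [Units.val_mul]
  show (!![u, 0; 0, (star u)⁻¹] : Matrix (Fin 2) (Fin 2) E) *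
      (!![1, δ; 0, 1] * !![1, 0; -δ⁻¹, 1] * !![1, δ; 0, 1]) =
      !![1, u * δ; 0, 1] * !![1, 0; -(u * δ)⁻¹, 1] * !![1, u * δ; 0, 1]
  rw [hus]
  ext i j
  fin_cases i <;> fin_cases j <;> simp [Matrix.mul_apply, Fin.sum_univ_two] <;>
    field_simp <;> ring

/-- A character of U(ℍ) is trivial on the split torus `diag(u, u⁻¹)`, `u ∈ F^×`. -/
theorem map_diagU_of_star_eq (hne : ∃ a : E, star a ≠ a) (hn : ∃ t : E, t ≠ 0 ∧ t * star t ≠ 1)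
    (u : E) (hu : u ≠ 0) (hus : star u = u) : φ (diagU u hu) = 1 := by
  obtain ⟨a, ha⟩ := hne
  have hδ : star (a - star a) = -(a - star a) := by rw [star_sub, star_star, neg_sub]
  have hδ0 : a - star a ≠ 0 := sub_ne_zero.mpr (Ne.symm ha)
  have h := congrArg φ (diagU_mul_wU u hu hus (a - star a) hδ0 hδ)
  rw [map_mul, map_wU φ hn, map_wU φ hn, mul_one] at h
  exact h

end generators

section torus

/-- The torus `Eˣ →* U(ℍ)`, `t ↦ diag(t, t̄⁻¹)`. -/
def diagHom : Eˣ →* hypUnitary E where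
  toFun t := diagU (t : E) t.ne_zero
  map_one' := by
    apply Subtype.ext
    apply Units.ext
    show (!![(1 : E), 0; 0, (star (1 : E))⁻¹] : Matrix (Fin 2) (Fin 2) E) = 1
    rw [Matrix.one_fin_two]
    simp
  map_mul' s t := by
    apply Subtype.ext
    apply Units.ext
    show (!![((s * t : Eˣ) : E), 0; 0, (star ((s * t : Eˣ) : E))⁻¹] : Matrix (Fin 2) (Fin 2) E) =
      !![(s : E), 0; 0, (star (s : E))⁻¹] * !![(t : E), 0; 0, (star (t : E))⁻¹]
    ext i j
    fin_cases i <;> fin_cases j <;> simp [Matrix.mul_apply, Fin.sum_univ_two, Units.val_mul, star_mul]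

/-- `diagHom t = diagU t _`. -/
theorem diagHom_apply (t : Eˣ) : diagHom t = diagU (t : E) t.ne_zero := rfl

/-- `det (diag(t, t̄⁻¹)) = t / t̄`: the determinant of the torus element is `jHom t`. -/
theorem detHom_diagHom (t : Eˣ) :
    detHom (diagHom t) = jHom (unitsConj (starRingAut : E ≃+* E)) t := by
  apply Units.ext
  rw [coe_detHom, coe_jHom, starRingAut_apply, diagHom_apply]
  show (!![(t : E), 0; 0, (star (t : E))⁻¹] : Matrix (Fin 2) (Fin 2) E).det = (t : E) / star (t : E)
  rw [Matrix.det_fin_two_of, div_eq_mul_inv]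
  ring

/-- The same in E¹: `detNormOne (diagHom t) = jHomNormOne t`. -/
theorem detNormOne_diagHom (t : Eˣ) :
    detNormOne (diagHom t) = jHomNormOne (starRingAut : E ≃+* E) starRingAut_involutive t := by
  apply Subtype.ext
  rw [coe_detNormOne, detHom_diagHom]
  apply Units.ext
  rw [coe_jHom, coe_jHomNormOne]

/-- `det : U(ℍ) → E¹` is surjective («det(M_Y) = E¹», Hilbert 90 on the torus). -/
theorem detNormOne_surjective (hne : ∃ a : E, star a ≠ a) :
    Function.Surjective (detNormOne : hypUnitary E →* _) := by
  intro y
  have hne' : ∃ a : E, starRingAut a ≠ a := by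
    obtain ⟨a, ha⟩ := hne
    exact ⟨a, by rwa [starRingAut_apply]⟩
  obtain ⟨t, ht⟩ := jHomNormOne_surjective (starRingAut : E ≃+* E) starRingAut_involutive hne' y
  exact ⟨diagHom t, by rw [detNormOne_diagHom, ht]⟩

end torus

end Summit.Ventures.HodgeRepro2.T5HyperbolicDet
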